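import Summits.Ventures.CertifiedQuantumChemistry.Certificates.HubbardRingL4U10DQGGap
import Summits.Ventures.CertifiedQuantumChemistry.Rows.GMatrixRelaxationKernel
import Summits.Ventures.CertifiedQuantumChemistry.Rows.HubbardRingTVEnergyFormula
import Literature.MathematicalPhysics.QuantumChemistry.SingletRestrictedRelaxation
import Summits.Ventures.CertifiedQuantumChemistry.Rows.ConjectureSU
import Literature.LinearAlgebra.Matrix.NearestPositiveSemidefinite
import HarnessLib

/-!
# Ventures/CertifiedQuantumChemistry — Certificates/HubbardRingL4SectorDual.lean: a TABLE-FORM DUAL CERTIFICATE for the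
# `(2,2)`-sector `DQG + ⟨Ŝ²⟩ = 0` programme of the Hubbard 4-ring — soundness (`μ ≤ c_d·Σ doublons + c_h·Σ bonds` on the
# singlet-feasible set) from three positive semidefinite dual tables, row multipliers, and a DECIDABLE coefficient check

HONEST FRAMING (verbatim): certified bounds for a stated model Hamiltonian in a stated basis; not a
claim about the real molecule beyond that model. A CERTIFICATE FORMAT (weak duality written out for one index set): no model
value, no row of `CERTIFIED.md`, no claim node.

Seat rdm-B (gen 44). The dual side of the cell's `L = 4` Lean line (gens 40–42 proved FLOORS on the scaled gap from explicit
feasible families; a CEILING needs a bound valid at EVERY feasible pair, i.e. a dual certificate). The object typed here is the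
Lagrangian certificate of Cancès–Stoltz–Lewin / Nakata et al. (Literature `DualConeLowerBound`: `E − μ = Σ_c tr(B_c·𝓛_c) +
Σ_r λ_r (A_r − b_r)`, `B_c ⪰ 0`) for the concrete index set `Orb (Fin 4) × Orb (Fin 4)` and the concrete row list of the tree's
printed sector programme — spin traces, block traces, the `S`-representability row (Mazziotti (98)) and the spin-resolved
contraction rows E2 (theorems of `Rows/GMatrixRelaxationKernel.lean`) — in a form whose only non-structural hypothesis is a
DECIDABLE identity of rational coefficient tables (`DualL4.Dual.check`), so that a certificate file discharges it by `decide`: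

* `DualL4.Dual` — the data: dual tables `zD, zQ, zG` on ordered pairs (paired with `Γ`, `Q(γ, Γ)`, `G(γ, Γ)` as
  `Σ_{I,J} z I J · Re M J I = Re tr(z·M)`), E2 multipliers `nu P k τ` (row `Σ_y Γ_{(P, yτ),(k, yτ)} = (2 − [τ = spin k])·γ_{P,k}`),
  trace multipliers, the exchange-row multiplier `xi`, and the target functional `cd·Σ_p Re Γ_{(p↑p↓),(p↑p↓)} + ch·Σ_{p,σ} Re γ_{pσ,(p+1)σ} − mu`;
* `Dual.defΓ / defγ / def0` — the coefficient tables of "target − pairings − rows" on the raw moments `Re Γ_{P,R}`, `Re γ_{x,y}`, `1`,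
  written with O(1) work per entry (the adjoints of `qMap` / `gMap` collapsed by hand); `Dual.check` — their CANONICAL forms vanish
  (Hermitian symmetrisation, fermionic antisymmetry in each pair, `S_z` selection of `γ` — the only relations used beyond the rows);
* `pairing_nonneg` (§2: each pairing is `Re tr` of a product of positive semidefinite matrices, `re_trace_mul_nonneg`),
  `sum_defΓ_canon` / `sum_defγ_canon` (§3: on Hermitian, pair-antisymmetric, `S_z`-diagonal data the raw defect sums are `1/8`, `1/2`
  of the canonical ones), and the index bookkeeping of §4 (delta collapses `collapseA…D`, the involution `gSwap`).
THE SOUNDNESS THEOREM itself (`Dual.le_of_check`: `check = true` + three PSD tables ⇒ `mu ≤ cd·Σ doublons + ch·Σ bonds` at every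
`IsDQGFeasibleSinglet 2 γ Γ`, and its spelling `U·mu ≤ Model.pqgSingletEnergy (hubbardRingTV 4 1 U) 2` for `cd = 1`, `ch = −2/U`) is the
companion file `Certificates/HubbardRingL4SectorDualSound.lean` (split for the 400-line lint). Nothing here is specific to one certificate:
the files `…L4SingletDual*.lean` instantiate `Dual` with an explicit polynomial-in-`1/U` family and discharge `check` by `decide`.
0 sorry; small `def`s (the data record, defect tables, `qConst`, the `Bool` check, `realZ`, `gSwap`), no `def … : Prop`; standard axioms. References (docstring-only):
E. Cancès, G. Stoltz, M. Lewin, J. Chem. Phys. 125 (2006) 064101 §3 eqs. (7)–(10); M. Nakata et al., J. Chem. Phys. 128 (2008) 164113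
§II.C–D; D. A. Mazziotti, Adv. Chem. Phys. 134 (2007) ch. 3 §II.B eqs. (14)–(16), §II.F eqs. (87)–(90), (98).
-/

set_option linter.style.longLine false

namespace Summit.Ventures.CertifiedQuantumChemistry

namespace DualL4

open Matrix Finset
open Literature.MathematicalPhysics.QuantumLattice Literature.MathematicalPhysics.QuantumChemistry
open Summit.Ventures.CertifiedQuantumChemistry.Hamiltonians
open scoped ComplexOrder

/-- Orbitals and ordered orbital pairs of the 4-ring. -/
abbrev O4 := Orb (Fin 4)
/-- Ordered pairs of spin orbitals of the 4-ring (the index set of `Γ`, `Q`, `G`). -/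
abbrev OP := Orb (Fin 4) × Orb (Fin 4)

/-- Site of a spin orbital. -/
def st (x : O4) : Fin 4 := (ofLex x).1
/-- Spin of a spin orbital. -/
def sp (x : O4) : Fin 2 := (ofLex x).2

/-- `st (orb p σ) = p`. -/
@[simp] theorem st_orb (p : Fin 4) (σ : Fin 2) : st (orb p σ) = p := rfl
/-- `sp (orb p σ) = σ`. -/
@[simp] theorem sp_orb (p : Fin 4) (σ : Fin 2) : sp (orb p σ) = σ := rfl
/-- Every spin orbital is `orb` of its site and spin. -/
theorem orb_st_sp (x : O4) : orb (st x) (sp x) = x := rfl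

/-! ## §1 The certificate data and its defect tables -/

/-- A table-form dual certificate for the `(2,2)`-sector `DQG (+S²)` programme of the 4-ring: three dual tables (to be positive
semidefinite), multipliers of the E2 rows `nu P k τ`, of the traces `Tr γ, Tr γ_↑, Tr γ_↓, Tr Γ_↑↑, Tr Γ_↓↓, Tr Γ_↑↓`, of the exchange
row `xi`, and the target `cd·Σ doublons + ch·Σ bonds ≥ mu`. -/
structure Dual where
  /-- dual table paired with `Γ`: `Σ_{I,J} zD I J · Re Γ J I` -/
  zD : OP → OP → ℚ
  /-- dual table paired with `Q(γ, Γ) = qMap γ Γ` -/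
  zQ : OP → OP → ℚ
  /-- dual table paired with `G(γ, Γ) = gMap γ Γ` -/
  zG : OP → OP → ℚ
  /-- multipliers of the E2 rows `Σ_y Γ_{(P, yτ),(k, yτ)} − (2 − [τ = spin k])·γ_{P,k} = 0` -/
  nu : O4 → O4 → Fin 2 → ℚ
  /-- multiplier of `Tr γ = 4` -/
  tOne : ℚ
  /-- multiplier of `Tr γ_↑ = 2` -/
  tUp : ℚ
  /-- multiplier of `Tr γ_↓ = 2` -/
  tDn : ℚ
  /-- multiplier of `Tr Γ_↑↑ = 2` -/
  tUU : ℚ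
  /-- multiplier of `Tr Γ_↓↓ = 2` -/
  tDD : ℚ
  /-- multiplier of `Tr Γ_↑↓ = 4` -/
  tUD : ℚ
  /-- multiplier of the exchange (`S`-representability) row `Σ_{xy} Γ_{(x↑,y↓),(y↑,x↓)} = 2` -/
  xi : ℚ
  /-- coefficient of the doublon sum in the target -/
  cd : ℚ
  /-- coefficient of the bond sum in the target -/
  ch : ℚ
  /-- the claimed lower bound -/
  mu : ℚ

namespace Dual

variable (d : Dual)

/-- Raw `Γ`-defect: coefficient of `Re Γ P R` in `target − pairings − rows` (each pairing's / row's adjoint written by hand). -/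
def defΓ (P R : OP) : ℚ :=
  (if P = R ∧ st P.1 = st P.2 ∧ sp P.1 = 0 ∧ sp P.2 = 1 then d.cd else 0)
  - d.zD R P - d.zQ P R + d.zG (R.1, P.2) (P.1, R.2)
  - (if P.2 = R.2 then d.nu P.1 R.1 (sp P.2) else 0)
  - (if P = R ∧ sp P.1 = 0 ∧ sp P.2 = 0 then d.tUU else 0)
  - (if P = R ∧ sp P.1 = 1 ∧ sp P.2 = 1 then d.tDD else 0)
  - (if P = R ∧ sp P.1 = 0 ∧ sp P.2 = 1 then d.tUD else 0)
  - (if sp P.1 = 0 ∧ sp P.2 = 1 ∧ sp R.1 = 0 ∧ sp R.2 = 1 ∧ st R.1 = st P.2 ∧ st R.2 = st P.1 then d.xi else 0)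

/-- Raw `γ`-defect: coefficient of `Re γ x y` in `target − pairings − rows`. -/
def defγ (x y : O4) : ℚ :=
  (if st y = finRotate 4 (st x) ∧ sp x = sp y then d.ch else 0)
  - (∑ m : O4, (- d.zQ (x, m) (y, m) + d.zQ (m, x) (y, m) + d.zQ (x, m) (m, y) - d.zQ (m, x) (m, y)))
  - (∑ m : O4, d.zG (y, m) (x, m))
  + (∑ τ : Fin 2, (2 - (if τ = sp y then 1 else 0)) * d.nu x y τ)
  - (if x = y then d.tOne else 0) - (if x = y ∧ sp x = 0 then d.tUp else 0) - (if x = y ∧ sp x = 1 then d.tDn else 0)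

/-- The constant part of `Re (qMap γ Γ J I)`: `[J = I] − [J = swap I]`. -/
def qConst (I J : OP) : ℚ := (if J.1 = I.1 ∧ J.2 = I.2 then 1 else 0) - (if J.1 = I.2 ∧ J.2 = I.1 then 1 else 0)

/-- Raw constant defect: `−mu − Σ zQ·qConst + (rhs of the rows)·multipliers`. -/
def def0 : ℚ :=
  - d.mu - (∑ I : OP, ∑ J : OP, d.zQ I J * qConst I J)
  + 4 * d.tOne + 2 * d.tUp + 2 * d.tDn + 2 * d.tUU + 2 * d.tDD + 4 * d.tUD + 2 * d.xi

/-- Canonical `Γ`-defect: signed sum over the 8 images of `(P, R)` under swapping inside `P`, inside `R`, and `P ↔ R`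
(vanishes entrywise iff the raw defect annihilates every Hermitian, pair-antisymmetric `Γ`). -/
def cdefΓ (P R : OP) : ℚ :=
  d.defΓ P R - d.defΓ P.swap R - d.defΓ P R.swap + d.defΓ P.swap R.swap
  + d.defΓ R P - d.defΓ R.swap P - d.defΓ R P.swap + d.defΓ R.swap P.swap

/-- Canonical `γ`-defect: Hermitian symmetrisation on same-spin entries (cross-spin entries of `γ` vanish by the `S_z` rule). -/
def cdefγ (x y : O4) : ℚ := if sp x = sp y then d.defγ x y + d.defγ y x else 0

/-- THE DECIDABLE CHECK (a `Bool`, evaluated by the kernel on literal data): all canonical defects vanish. -/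
def check : Bool :=
  decide ((∀ p : Fin 4, ∀ σ : Fin 2, ∀ q : Fin 4, ∀ τ : Fin 2, ∀ r : Fin 4, ∀ υ : Fin 2, ∀ s : Fin 4, ∀ φ : Fin 2,
      d.cdefΓ (orb p σ, orb q τ) (orb r υ, orb s φ) = 0) ∧
    (∀ p : Fin 4, ∀ σ : Fin 2, ∀ q : Fin 4, ∀ τ : Fin 2, d.cdefγ (orb p σ) (orb q τ) = 0) ∧
    d.def0 = 0)

/-- What a passing `check` says. -/
theorem check_spec (h : d.check = true) :
    (∀ p : Fin 4, ∀ σ : Fin 2, ∀ q : Fin 4, ∀ τ : Fin 2, ∀ r : Fin 4, ∀ υ : Fin 2, ∀ s : Fin 4, ∀ φ : Fin 2,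
        d.cdefΓ (orb p σ, orb q τ) (orb r υ, orb s φ) = 0) ∧
      (∀ p : Fin 4, ∀ σ : Fin 2, ∀ q : Fin 4, ∀ τ : Fin 2, d.cdefγ (orb p σ) (orb q τ) = 0) ∧ d.def0 = 0 :=
  of_decide_eq_true h

/-- The three dual tables as real matrices. -/
noncomputable def realZ (z : OP → OP → ℚ) : Matrix OP OP ℝ := Matrix.of fun I J => ((z I J : ℚ) : ℝ)

end Dual

/-! ## §2 Pairings are nonnegative (weak duality) -/

section Pairing

/-- `Re tr(zℂ · M) = Σ_{I,J} z I J · Re (M J I)` for a rational table `z`. -/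
theorem re_trace_mul_eq (z : OP → OP → ℚ) (M : Matrix OP OP ℂ) :
    RCLike.re (((Dual.realZ z).map Complex.ofRealHom) * M).trace = ∑ I : OP, ∑ J : OP, ((z I J : ℚ) : ℝ) * (M J I).re := by
  simp only [Matrix.trace, Matrix.diag, Matrix.mul_apply, Dual.realZ, Matrix.map_apply, Matrix.of_apply, Complex.ofRealHom_eq_coe]
  rw [show (RCLike.re (∑ I : OP, ∑ J : OP, ((((z I J : ℚ) : ℝ) : ℂ)) * M J I) : ℝ) =
      (∑ I : OP, ∑ J : OP, ((((z I J : ℚ) : ℝ) : ℂ)) * M J I).re from rfl]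
  rw [Complex.re_sum]
  refine Finset.sum_congr rfl fun I _ => ?_
  rw [Complex.re_sum]
  refine Finset.sum_congr rfl fun J _ => ?_
  rw [Complex.re_ofReal_mul]

/-- Weak duality for one cone: a positive semidefinite real table paired with a positive semidefinite block is `≥ 0`. -/
theorem pairing_nonneg {z : OP → OP → ℚ} (hz : (Dual.realZ z).PosSemidef) {M : Matrix OP OP ℂ} (hM : M.PosSemidef) :
    0 ≤ ∑ I : OP, ∑ J : OP, ((z I J : ℚ) : ℝ) * (M J I).re := by
  rw [← re_trace_mul_eq]
  exact Literature.LinearAlgebra.Matrix.NearestPositiveSemidefinite.re_trace_mul_nonneg (DQGGap.posSemidef_map_ofReal hz) hM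

end Pairing

/-! ## §3 Canonical forms: only Hermiticity, pair antisymmetry and the `S_z` rule are used -/

section Canon

variable {γ : Matrix O4 O4 ℂ} {Γ : Matrix OP OP ℂ}

/-- `Σ f(P.swap, R)·Re Γ = −Σ f·Re Γ` under antisymmetry in the first pair. -/
theorem sum_swap_fst (f : OP → OP → ℝ) (hfst : ∀ i j q, Γ (j, i) q = -Γ (i, j) q) :
    ∑ P : OP, ∑ R : OP, f P.swap R * (Γ P R).re = - ∑ P : OP, ∑ R : OP, f P R * (Γ P R).re := by
  rw [← (Equiv.prodComm O4 O4).sum_comp]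
  simp only [Equiv.prodComm_apply]
  rw [← Finset.sum_neg_distrib]
  refine Finset.sum_congr rfl fun P _ => ?_
  rw [← Finset.sum_neg_distrib]
  refine Finset.sum_congr rfl fun R _ => ?_
  obtain ⟨i, j⟩ := P
  simp only [Prod.swap_prod_mk, hfst i j R, Complex.neg_re]
  ring

/-- `Σ f(P, R.swap)·Re Γ = −Σ f·Re Γ` under antisymmetry in the second pair. -/
theorem sum_swap_snd (f : OP → OP → ℝ) (hsnd : ∀ p k l, Γ p (l, k) = -Γ p (k, l)) :
    ∑ P : OP, ∑ R : OP, f P R.swap * (Γ P R).re = - ∑ P : OP, ∑ R : OP, f P R * (Γ P R).re := by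
  rw [← Finset.sum_neg_distrib]
  refine Finset.sum_congr rfl fun P _ => ?_
  rw [← (Equiv.prodComm O4 O4).sum_comp]
  simp only [Equiv.prodComm_apply]
  rw [← Finset.sum_neg_distrib]
  refine Finset.sum_congr rfl fun R _ => ?_
  obtain ⟨k, l⟩ := R
  simp only [Prod.swap_prod_mk, hsnd P k l, Complex.neg_re]
  ring

/-- `Σ f(R, P)·Re Γ = Σ f·Re Γ` for Hermitian `Γ`. -/
theorem sum_transpose (f : OP → OP → ℝ) (hH : Γ.IsHermitian) :
    ∑ P : OP, ∑ R : OP, f R P * (Γ P R).re = ∑ P : OP, ∑ R : OP, f P R * (Γ P R).re := by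
  rw [Finset.sum_comm]
  refine Finset.sum_congr rfl fun P _ => Finset.sum_congr rfl fun R _ => ?_
  rw [← hH.apply P R, RCLike.star_def, Complex.conj_re]

/-- The raw `Γ`-defect sum equals `1/8` of the canonical one (Hermitian, pair-antisymmetric `Γ`). -/
theorem sum_defΓ_canon (d : Dual) (hH : Γ.IsHermitian) (hfst : ∀ i j q, Γ (j, i) q = -Γ (i, j) q)
    (hsnd : ∀ p k l, Γ p (l, k) = -Γ p (k, l)) :
    ∑ P : OP, ∑ R : OP, ((d.defΓ P R : ℚ) : ℝ) * (Γ P R).re =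
      (1 / 8 : ℝ) * ∑ P : OP, ∑ R : OP, ((d.cdefΓ P R : ℚ) : ℝ) * (Γ P R).re := by
  set f : OP → OP → ℝ := fun P R => ((d.defΓ P R : ℚ) : ℝ) with hf
  have e1 := sum_swap_fst (Γ := Γ) f hfst
  have e2 := sum_swap_snd (Γ := Γ) f hsnd
  have e4 := sum_transpose (Γ := Γ) f hH
  have key : ∑ P : OP, ∑ R : OP, ((d.cdefΓ P R : ℚ) : ℝ) * (Γ P R).re = 8 * ∑ P : OP, ∑ R : OP, f P R * (Γ P R).re := by
    have expand : ∀ P R : OP, ((d.cdefΓ P R : ℚ) : ℝ) * (Γ P R).re =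
        f P R * (Γ P R).re - f P.swap R * (Γ P R).re - f P R.swap * (Γ P R).re + f P.swap R.swap * (Γ P R).re
        + f R P * (Γ P R).re - f R.swap P * (Γ P R).re - f R P.swap * (Γ P R).re + f R.swap P.swap * (Γ P R).re := by
      intro P R; simp only [hf, Dual.cdefΓ]; push_cast; ring
    simp only [expand, Finset.sum_add_distrib, Finset.sum_sub_distrib]
    -- each of the eight sums is ± the raw sum
    have s2 : ∑ P : OP, ∑ R : OP, f P.swap R * (Γ P R).re = - ∑ P : OP, ∑ R : OP, f P R * (Γ P R).re := e1
    have s3 : ∑ P : OP, ∑ R : OP, f P R.swap * (Γ P R).re = - ∑ P : OP, ∑ R : OP, f P R * (Γ P R).re := e2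
    have s4 : ∑ P : OP, ∑ R : OP, f P.swap R.swap * (Γ P R).re = ∑ P : OP, ∑ R : OP, f P R * (Γ P R).re := by
      have h1 : ∑ P : OP, ∑ R : OP, (fun P R => f P.swap R) P R.swap * (Γ P R).re =
          - ∑ P : OP, ∑ R : OP, (fun P R => f P.swap R) P R * (Γ P R).re := sum_swap_snd (Γ := Γ) (fun P R => f P.swap R) hsnd
      simp only at h1
      rw [h1, e1]; ring
    have s5 : ∑ P : OP, ∑ R : OP, f R P * (Γ P R).re = ∑ P : OP, ∑ R : OP, f P R * (Γ P R).re := e4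
    have s6 : ∑ P : OP, ∑ R : OP, f R.swap P * (Γ P R).re = - ∑ P : OP, ∑ R : OP, f P R * (Γ P R).re := by
      have := sum_swap_snd (Γ := Γ) (fun P R => f R P) hsnd
      -- f (R.swap) P = (fun P R => f R P) P R.swap
      simpa [e4] using this
    have s7 : ∑ P : OP, ∑ R : OP, f R P.swap * (Γ P R).re = - ∑ P : OP, ∑ R : OP, f P R * (Γ P R).re := by
      have := sum_swap_fst (Γ := Γ) (fun P R => f R P) hfst
      simpa [e4] using this
    have s8 : ∑ P : OP, ∑ R : OP, f R.swap P.swap * (Γ P R).re = ∑ P : OP, ∑ R : OP, f P R * (Γ P R).re := by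
      have h1 : ∑ P : OP, ∑ R : OP, (fun P R => f R.swap P) P.swap R * (Γ P R).re =
          - ∑ P : OP, ∑ R : OP, (fun P R => f R.swap P) P R * (Γ P R).re := sum_swap_fst (Γ := Γ) (fun P R => f R.swap P) hfst
      simp only at h1
      rw [h1, s6]; ring
    rw [s2, s3, s4, s5, s6, s7, s8]; ring
  rw [key]; ring

/-- The raw `γ`-defect sum equals `1/2` of the canonical one (Hermitian `γ` obeying the `S_z` selection rule). -/
theorem sum_defγ_canon (d : Dual) (hγ : γ.IsHermitian) (hsel : ∀ p q : Fin 4, ∀ σ τ : Fin 2, σ ≠ τ → γ (orb p σ) (orb q τ) = 0) :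
    ∑ x : O4, ∑ y : O4, ((d.defγ x y : ℚ) : ℝ) * (γ x y).re =
      (1 / 2 : ℝ) * ∑ x : O4, ∑ y : O4, ((d.cdefγ x y : ℚ) : ℝ) * (γ x y).re := by
  have hsel' : ∀ x y : O4, sp x ≠ sp y → (γ x y).re = 0 := by
    intro x y h
    rw [← orb_st_sp x, ← orb_st_sp y, hsel _ _ _ _ h, Complex.zero_re]
  have hsymm : ∀ x y : O4, (γ y x).re = (γ x y).re := by
    intro x y
    rw [← hγ.apply x y, RCLike.star_def, Complex.conj_re]
  have key : ∑ x : O4, ∑ y : O4, ((d.cdefγ x y : ℚ) : ℝ) * (γ x y).re = 2 * ∑ x : O4, ∑ y : O4, ((d.defγ x y : ℚ) : ℝ) * (γ x y).re := by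
    have expand : ∀ x y : O4, ((d.cdefγ x y : ℚ) : ℝ) * (γ x y).re =
        ((d.defγ x y : ℚ) : ℝ) * (γ x y).re + ((d.defγ y x : ℚ) : ℝ) * (γ x y).re := by
      intro x y
      simp only [Dual.cdefγ]
      by_cases h : sp x = sp y
      · rw [if_pos h]; push_cast; ring
      · rw [if_neg h, hsel' x y h]; push_cast; ring
    simp only [expand, Finset.sum_add_distrib]
    have hT : ∑ x : O4, ∑ y : O4, ((d.defγ y x : ℚ) : ℝ) * (γ x y).re = ∑ x : O4, ∑ y : O4, ((d.defγ x y : ℚ) : ℝ) * (γ x y).re := by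
      rw [Finset.sum_comm]
      exact Finset.sum_congr rfl fun x _ => Finset.sum_congr rfl fun y _ => by rw [hsymm]
    rw [hT]; ring
  rw [key]; ring

end Canon

/-! ## §4 Index bookkeeping: sums over orbitals / pairs, delta collapses, reorderings -/

section Sums

/-- A sum over the spin orbitals is an iterated sum over sites and spins. -/
theorem sum_orb4 {M : Type*} [AddCommMonoid M] (f : O4 → M) : ∑ x : O4, f x = ∑ p : Fin 4, ∑ σ : Fin 2, f (orb p σ) := by
  rw [← Fintype.sum_prod_type', ← (toLex : Fin 4 × Fin 2 ≃ O4).sum_comp]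

/-- A sum over ordered pairs is an iterated sum over the two orbitals. -/
theorem sum_OP {M : Type*} [AddCommMonoid M] (f : OP → M) : ∑ P : OP, f P = ∑ x : O4, ∑ y : O4, f (x, y) := by
  rw [← Fintype.sum_prod_type']

/-- The involution `((I₁,I₂),(J₁,J₂)) ↦ ((J₁,I₂),(I₁,J₂))` of `OP × OP` (index map of the `Γ`-part of the `G`-pairing). -/
def gSwap : OP × OP ≃ OP × OP where
  toFun x := ((x.2.1, x.1.2), (x.1.1, x.2.2))
  invFun x := ((x.2.1, x.1.2), (x.1.1, x.2.2))
  left_inv := fun ⟨⟨_, _⟩, ⟨_, _⟩⟩ => rfl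
  right_inv := fun ⟨⟨_, _⟩, ⟨_, _⟩⟩ => rfl

/-- Reindexing a double sum over ordered pairs along `gSwap`. -/
theorem sum_OP2_gSwap {M : Type*} [AddCommMonoid M] (F : OP → OP → M) :
    ∑ I : OP, ∑ J : OP, F I J = ∑ P : OP, ∑ R : OP, F (R.1, P.2) (P.1, R.2) := by
  rw [← Fintype.sum_prod_type', ← Fintype.sum_prod_type', ← gSwap.sum_comp]
  rfl

variable (F : O4 → O4 → O4 → ℝ)

/-- Swap the two outer sums of a triple sum. -/
theorem sum3_213 : ∑ a : O4, ∑ b : O4, ∑ c : O4, F a b c = ∑ b : O4, ∑ a : O4, ∑ c : O4, F a b c := Finset.sum_comm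

/-- Swap the two inner sums of a triple sum. -/
theorem sum3_132 : ∑ a : O4, ∑ b : O4, ∑ c : O4, F a b c = ∑ a : O4, ∑ c : O4, ∑ b : O4, F a b c :=
  Finset.sum_congr rfl fun _ _ => Finset.sum_comm

/-- Shape A: `Σ_{I,J} z I J·[J₂=I₂]·g J₁ I₁ = Σ_{x,y} (Σ_m z (y,m) (x,m))·g x y`. -/
theorem collapseA (z : OP → OP → ℝ) (g : O4 → O4 → ℝ) :
    ∑ I : OP, ∑ J : OP, z I J * (if J.2 = I.2 then g J.1 I.1 else 0) = ∑ x : O4, ∑ y : O4, (∑ m : O4, z (y, m) (x, m)) * g x y := by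
  simp only [sum_OP, Finset.sum_mul]
  have h : ∀ I1 I2 J1 : O4, ∑ J2 : O4, z (I1, I2) (J1, J2) * (if J2 = I2 then g J1 I1 else 0) = z (I1, I2) (J1, I2) * g J1 I1 := by
    intro I1 I2 J1; simp only [mul_ite, mul_zero, Finset.sum_ite_eq', Finset.mem_univ, if_true]
  simp only [h]
  -- Σ I1 Σ I2 Σ J1 H = Σ x Σ y Σ m H(y, m, x): bring J1 to the front
  rw [sum3_132 (fun I1 I2 J1 => z (I1, I2) (J1, I2) * g J1 I1), sum3_213]

/-- Shape A': `Σ_{I,J} z I J·[J₂=I₂]·g I₁ J₁ = Σ_{x,y} (Σ_m z (x,m) (y,m))·g x y`. -/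
theorem collapseA' (z : OP → OP → ℝ) (g : O4 → O4 → ℝ) :
    ∑ I : OP, ∑ J : OP, z I J * (if J.2 = I.2 then g I.1 J.1 else 0) = ∑ x : O4, ∑ y : O4, (∑ m : O4, z (x, m) (y, m)) * g x y := by
  simp only [sum_OP, Finset.sum_mul]
  have h : ∀ I1 I2 J1 : O4, ∑ J2 : O4, z (I1, I2) (J1, J2) * (if J2 = I2 then g I1 J1 else 0) = z (I1, I2) (J1, I2) * g I1 J1 := by
    intro I1 I2 J1; simp only [mul_ite, mul_zero, Finset.sum_ite_eq', Finset.mem_univ, if_true]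
  simp only [h]
  rw [sum3_132]

/-- Shape B: `Σ_{I,J} z I J·[J₂=I₁]·g I₂ J₁ = Σ_{x,y} (Σ_m z (m,x) (y,m))·g x y`. -/
theorem collapseB (z : OP → OP → ℝ) (g : O4 → O4 → ℝ) :
    ∑ I : OP, ∑ J : OP, z I J * (if J.2 = I.1 then g I.2 J.1 else 0) = ∑ x : O4, ∑ y : O4, (∑ m : O4, z (m, x) (y, m)) * g x y := by
  simp only [sum_OP, Finset.sum_mul]
  have h : ∀ I1 I2 J1 : O4, ∑ J2 : O4, z (I1, I2) (J1, J2) * (if J2 = I1 then g I2 J1 else 0) = z (I1, I2) (J1, I1) * g I2 J1 := by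
    intro I1 I2 J1; simp only [mul_ite, mul_zero, Finset.sum_ite_eq', Finset.mem_univ, if_true]
  simp only [h]
  -- current Σ m Σ x Σ y ; want Σ x Σ y Σ m
  rw [sum3_213 (fun I1 I2 J1 => z (I1, I2) (J1, I1) * g I2 J1), sum3_132]

/-- Shape C: `Σ_{I,J} z I J·[J₁=I₂]·g I₁ J₂ = Σ_{x,y} (Σ_m z (x,m) (m,y))·g x y`. -/
theorem collapseC (z : OP → OP → ℝ) (g : O4 → O4 → ℝ) :
    ∑ I : OP, ∑ J : OP, z I J * (if J.1 = I.2 then g I.1 J.2 else 0) = ∑ x : O4, ∑ y : O4, (∑ m : O4, z (x, m) (m, y)) * g x y := by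
  simp only [sum_OP, Finset.sum_mul]
  have h : ∀ I1 I2 : O4, ∑ J1 : O4, ∑ J2 : O4, z (I1, I2) (J1, J2) * (if J1 = I2 then g I1 J2 else 0) =
      ∑ J2 : O4, z (I1, I2) (I2, J2) * g I1 J2 := by
    intro I1 I2
    rw [Finset.sum_comm]
    refine Finset.sum_congr rfl fun J2 _ => ?_
    simp only [mul_ite, mul_zero, Finset.sum_ite_eq', Finset.mem_univ, if_true]
  simp only [h]
  rw [sum3_132]

/-- Shape D: `Σ_{I,J} z I J·[J₁=I₁]·g I₂ J₂ = Σ_{x,y} (Σ_m z (m,x) (m,y))·g x y`. -/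
theorem collapseD (z : OP → OP → ℝ) (g : O4 → O4 → ℝ) :
    ∑ I : OP, ∑ J : OP, z I J * (if J.1 = I.1 then g I.2 J.2 else 0) = ∑ x : O4, ∑ y : O4, (∑ m : O4, z (m, x) (m, y)) * g x y := by
  simp only [sum_OP, Finset.sum_mul]
  have h : ∀ I1 I2 : O4, ∑ J1 : O4, ∑ J2 : O4, z (I1, I2) (J1, J2) * (if J1 = I1 then g I2 J2 else 0) =
      ∑ J2 : O4, z (I1, I2) (I1, J2) * g I2 J2 := by
    intro I1 I2
    rw [Finset.sum_comm]
    refine Finset.sum_congr rfl fun J2 _ => ?_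
    simp only [mul_ite, mul_zero, Finset.sum_ite_eq', Finset.mem_univ, if_true]
  simp only [h]
  rw [sum3_213 (fun I1 I2 J2 => z (I1, I2) (I1, J2) * g I2 J2), sum3_132]

end Sums

end DualL4

end Summit.Ventures.CertifiedQuantumChemistry
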